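import Summits.Ventures.PercRepro.C025ProfileRankFourDemA

/-!
# The rank-4 certificate: fact (F4) — a pair on a line with two more points has a spanning complement (night-3 g7)

NIGHT3-G7-RANK4-CERTIFICATE.md §1 (F4): in a simple matroid of rank `4`, a rank-`2` set `B` with `j(B) = 2` (its line
has at least two points outside `B`) has `ρ(E ∖ B) = 4`: otherwise `E ∖ B` lies in a flat `P` of rank `≤ 3` containing two
points of the line `cl B`, hence `cl B`, hence `B`, hence `E`.
-/

open scoped Matroid

namespace PercRepro

open Set Finset ThmH

section RankFourFacts

variable {α : Type} [DecidableEq α] {M : Matroid α} [M.Finite]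

/-- **(F4)**: in a simple matroid of rank `4`, `j(B) = 2` forces `ρ(E ∖ B) = 4`. -/
theorem crk_eq_four_of_jB_eq_two (hR : M.eRank = (4 : ℕ∞)) (hsimple : ∀ T ⊆ M.E, T.encard ≤ 2 → M.Indep T)
    {B : Finset α} (hB : B ∈ Profile.Rq M 2) (hj : jB M B = 2) : crk M B = 4 := by
  rw [Profile.mem_Rq] at hB
  obtain ⟨hBg, hB2⟩ := hB
  have hfin : M.eRk ((gr M \ B : Finset α) : Set α) ≠ ⊤ := by
    rw [← lt_top_iff_ne_top]; exact (M.isRkFinite_set _).eRk_lt_top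
  have hle : crk M B ≤ 4 := by
    unfold crk
    have := M.eRk_le_eRank ((gr M \ B : Finset α) : Set α)
    rw [hR, ← ENat.coe_toNat hfin] at this
    exact_mod_cast this
  by_contra hne
  have hlt : (M.eRk ((gr M \ B : Finset α) : Set α)) ≤ (3 : ℕ∞) := by
    have h3 : crk M B ≤ 3 := by omega
    unfold crk at h3
    rw [← ENat.coe_toNat hfin]; exact_mod_cast h3
  -- two points of the line outside B
  have hc : 2 ≤ (clF M B \ B).card := by
    unfold jB at hj
    rw [Finset.card_sdiff_of_subset (subset_clF_self hBg)]
    omega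
  obtain ⟨U, hUT, hUc⟩ := Finset.exists_subset_card_eq hc
  have hUg : (U : Set α) ⊆ M.E := by
    rw [← coe_gr]; exact_mod_cast hUT.trans (Finset.sdiff_subset.trans (clF_subset_gr B))
  have hUind : M.Indep (U : Set α) := hsimple _ hUg (by rw [Set.encard_coe_eq_coe_finsetCard, hUc]; rfl)
  have hU2 : M.eRk (U : Set α) = 2 := by rw [hUind.eRk_eq_encard, Set.encard_coe_eq_coe_finsetCard, hUc]; rfl
  have hUcl : (U : Set α) ⊆ M.closure (B : Set α) := by
    intro x hx
    have := hUT (by exact_mod_cast hx)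
    rw [Finset.mem_sdiff, ← Finset.mem_coe, coe_clF] at this
    exact this.1
  -- B ⊆ cl U : every b ∈ B does not raise the rank of U
  have hBcl : (B : Set α) ⊆ M.closure (U : Set α) := by
    intro b hb
    have hbE : b ∈ M.E := by rw [← coe_gr]; exact_mod_cast hBg (by exact_mod_cast hb)
    apply mem_closure_of_eRk_insert_le hbE (by rw [hU2]; exact ENat.coe_ne_top 2)
    rw [hU2]
    calc M.eRk (insert b (U : Set α)) ≤ M.eRk (M.closure (B : Set α)) :=
          M.eRk_mono (Set.insert_subset (M.subset_closure _ (by rw [← coe_gr]; exact_mod_cast hBg) hb) hUcl)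
      _ = 2 := by rw [M.eRk_closure_eq, hB2]; rfl
  -- U ⊆ E ∖ B, so B ⊆ cl U ⊆ cl(E ∖ B), so E ⊆ cl(E ∖ B)
  have hUsub : (U : Set α) ⊆ ((gr M \ B : Finset α) : Set α) := by
    intro x hx
    have := hUT (by exact_mod_cast hx)
    rw [Finset.mem_sdiff] at this
    rw [Finset.mem_coe, Finset.mem_sdiff]
    exact ⟨clF_subset_gr B this.1, this.2⟩
  have hEsub : M.E ⊆ M.closure ((gr M \ B : Finset α) : Set α) := by
    intro x hx
    by_cases hxB : x ∈ B
    · exact M.closure_subset_closure hUsub (hBcl (by exact_mod_cast hxB))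
    · apply M.subset_closure _ (by rw [Finset.coe_sdiff, coe_gr]; exact Set.sdiff_subset)
      rw [Finset.mem_coe, Finset.mem_sdiff]
      exact ⟨by rw [← Finset.mem_coe, coe_gr]; exact hx, hxB⟩
  have : M.eRank ≤ (3 : ℕ∞) := by
    calc M.eRank = M.eRk M.E := M.eRank_def
      _ ≤ M.eRk (M.closure ((gr M \ B : Finset α) : Set α)) := M.eRk_mono hEsub
      _ = M.eRk ((gr M \ B : Finset α) : Set α) := M.eRk_closure_eq _
      _ ≤ 3 := hlt
  rw [hR] at this
  exact absurd this (by decide)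

omit [DecidableEq α] in
/-- **(F5)**: in a simple matroid, a line (the closure of a rank-`2` set `B`) with two distinct points in a set `X` lies in
the closure of `X`. -/
theorem clF_subset_closure_of_two_mem (hsimple : ∀ T ⊆ M.E, T.encard ≤ 2 → M.Indep T) {B : Finset α}
    (hB2 : M.eRk (B : Set α) = 2) {X : Set α} {x x' : α} (hxx' : x ≠ x')
    (hx : x ∈ clF M B) (hx' : x' ∈ clF M B) (hxX : x ∈ X) (hx'X : x' ∈ X) :
    ((clF M B : Finset α) : Set α) ⊆ M.closure X := by
  have hxE : x ∈ M.E := by rw [← coe_gr]; exact_mod_cast clF_subset_gr B hx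
  have hx'E : x' ∈ M.E := by rw [← coe_gr]; exact_mod_cast clF_subset_gr B hx'
  have hUE : ({x, x'} : Set α) ⊆ M.E := by
    intro z hz; rw [Set.mem_insert_iff, Set.mem_singleton_iff] at hz
    rcases hz with rfl | rfl
    · exact hxE
    · exact hx'E
  have hUind : M.Indep ({x, x'} : Set α) := hsimple _ hUE (by rw [Set.encard_pair hxx'])
  have hU2 : M.eRk ({x, x'} : Set α) = 2 := by rw [hUind.eRk_eq_encard, Set.encard_pair hxx']
  have hUcl : ({x, x'} : Set α) ⊆ M.closure (B : Set α) := by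
    intro z hz; rw [Set.mem_insert_iff, Set.mem_singleton_iff] at hz
    rcases hz with rfl | rfl
    · rw [← Finset.mem_coe, coe_clF] at hx; exact hx
    · rw [← Finset.mem_coe, coe_clF] at hx'; exact hx'
  -- cl B ⊆ cl {x, x'}: every point of cl B does not raise the rank of {x, x'}
  have hcl : M.closure (B : Set α) ⊆ M.closure ({x, x'} : Set α) := by
    intro b hb
    have hbE : b ∈ M.E := M.closure_subset_ground _ hb
    apply mem_closure_of_eRk_insert_le hbE (by rw [hU2]; exact ENat.coe_ne_top 2)
    rw [hU2]
    calc M.eRk (insert b ({x, x'} : Set α)) ≤ M.eRk (M.closure (B : Set α)) :=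
          M.eRk_mono (Set.insert_subset hb hUcl)
      _ = 2 := by rw [M.eRk_closure_eq, hB2]
  have hUX : ({x, x'} : Set α) ⊆ X := by
    intro z hz; rw [Set.mem_insert_iff, Set.mem_singleton_iff] at hz
    rcases hz with rfl | rfl
    · exact hxX
    · exact hx'X
  calc ((clF M B : Finset α) : Set α) = M.closure (B : Set α) := coe_clF M B
    _ ⊆ M.closure ({x, x'} : Set α) := hcl
    _ ⊆ M.closure X := M.closure_subset_closure hUX

/-- **(Cap)(d), the uniqueness step**: in a simple matroid, a rank-`3` set `S` with at least five points has at most one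
point `y` with `S ∖ {y}` of rank `2` — two such points would put `S` inside one line. -/
theorem eq_of_erase_eRk_two (hsimple : ∀ T ⊆ M.E, T.encard ≤ 2 → M.Indep T) {S : Finset α} (hS : S ⊆ gr M)
    (hS3 : M.eRk (S : Set α) = 3) (hS5 : 5 ≤ S.card) {y y' : α} (hy : y ∈ S) (hy' : y' ∈ S)
    (h2 : M.eRk ((S.erase y : Finset α) : Set α) = 2) (h2' : M.eRk ((S.erase y' : Finset α) : Set α) = 2) : y = y' := by
  by_contra hne
  -- two points of S other than y, y'
  have hc : 2 ≤ ((S.erase y).erase y').card := by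
    rw [Finset.card_erase_of_mem (Finset.mem_erase.2 ⟨Ne.symm hne, hy'⟩), Finset.card_erase_of_mem hy]; omega
  obtain ⟨U, hUsub, hUc⟩ := Finset.exists_subset_card_eq hc
  obtain ⟨x, x', hxx', hU⟩ := Finset.card_eq_two.1 hUc
  have hxU : x ∈ (S.erase y).erase y' := hUsub (by rw [hU]; exact Finset.mem_insert_self _ _)
  have hx'U : x' ∈ (S.erase y).erase y' := hUsub (by rw [hU]; exact Finset.mem_insert_of_mem (Finset.mem_singleton_self _))
  have hxy : x ∈ S.erase y := (Finset.mem_erase.1 hxU).2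
  have hx'y : x' ∈ S.erase y := (Finset.mem_erase.1 hx'U).2
  have hxy' : x ∈ S.erase y' := Finset.mem_erase.2 ⟨(Finset.mem_erase.1 hxU).1, (Finset.mem_erase.1 hxy).2⟩
  have hx'y' : x' ∈ S.erase y' := Finset.mem_erase.2 ⟨(Finset.mem_erase.1 hx'U).1, (Finset.mem_erase.1 hx'y).2⟩
  have hBg : S.erase y ⊆ gr M := (Finset.erase_subset _ _).trans hS
  -- the line of S ∖ y lies in cl(S ∖ y'), which has rank 2; so S ⊆ cl(S ∖ y')
  have hline : ((clF M (S.erase y) : Finset α) : Set α) ⊆ M.closure ((S.erase y' : Finset α) : Set α) :=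
    clF_subset_closure_of_two_mem hsimple h2 hxx' (subset_clF_self hBg hxy) (subset_clF_self hBg hx'y)
      (by exact_mod_cast hxy') (by exact_mod_cast hx'y')
  have hSsub : (S : Set α) ⊆ M.closure ((S.erase y' : Finset α) : Set α) := by
    intro z hz
    by_cases hzy : z = y
    · subst hzy
      exact M.subset_closure _ (by rw [← coe_gr]; exact_mod_cast (Finset.erase_subset _ _).trans hS)
        (by rw [Finset.mem_coe, Finset.mem_erase]; exact ⟨hne, hy⟩)
    · have : z ∈ S.erase y := Finset.mem_erase.2 ⟨hzy, by exact_mod_cast hz⟩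
      exact hline (subset_clF_self hBg this)
  have : M.eRk (S : Set α) ≤ 2 := by
    calc M.eRk (S : Set α) ≤ M.eRk (M.closure ((S.erase y' : Finset α) : Set α)) := M.eRk_mono hSsub
      _ = 2 := by rw [M.eRk_closure_eq, h2']
  rw [hS3] at this
  exact absurd this (by decide)

end RankFourFacts

end PercRepro
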